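import Summits.ABC.IUTFork.Joshi.TestATS4LowerBoundGenuineRealisingCyclotomic
import Summits.ABC.IUTFork.Conditional.AbcOfSGenuineSideVacuity
import HarnessLib

/-!
# R-J census, row Y-21ℓ — lane-2 wording guard G2 IN KERNEL: the REALISING regime of
# `TestATS4LowerBoundGenuineRealising` (p472542) holds NO pilot datum OF an initial Θ-datum over its field

Proof-only record file of the abc-iut cell, branch E → R-J «Joshi Y-discharge census» (D-0079; rung LADDER-ABC:A2.RESCUE.J);
author abc-iut-E-cx-2 (block E second adversary lane), filed by proxy. **No side is taken** on [IUTchIII] Cor. 3.12 /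
[IUTchIV] Thm 1.10 / [IUTchI] Def. 3.1, on [J-III] Cor 9.11.1.1 / [J-IV] (unrefereed arXiv preprints) or on any author;
typed ≠ proved ≠ endorsed; instantiated ≠ endorsed; no definition, no `Prop` fact, no instance.

WHAT THIS RECORDS. abc-iut-E-t59's part III `TestATS4LowerBound.statement_and_not_cor91111_of_realising` refutes the converse of
row Y-21ℓ at pilot data `X : PilotData F` carrying ideles that REALISE `P_q` in print's normalisation — its hypothesis `htq`:
`log ‖t_{q,v}‖ = −X.qPilot(v)·log N(v)/n_v` — in the regime `hord : ord_v(q_v) = 2l·e_v·m_q(p)` over a set `U` of odd primes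
UNRAMIFIED in `F`; part IV inhabits every hypothesis over `ℚ(ζ₅)` (`j_E := 3^{−10}`, `l := 5`). Block C's kernel finding C-R16
(abc-iut-C-cert-3, `Conditional.SideVacuity.not_realising_qIdeles_of_isPilotDataOf`, p432420) is LITERALLY the negation of `htq`
whenever `X` is the pilot datum OF an initial Θ-datum `D` over `F` (`Cor312Prov.IsPilotDataOf D X`): [IUTchI] Def. 3.1 (c), as
typed by `InitialThetaData.l_coprime_qParamOrd`, makes `l` coprime to every `ord_v(q_v)`, while a realising idele forces
`2l ∣ ord_v(q_v)`. Composing the two BY NAME: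
* `not_isPilotDataOf_of_realising_qIdeles` — if SOME non-zero `q`-idele realises `P_q` at `X`, then `X` is the pilot datum of NO
  initial Θ-datum over `F`;
* `not_isPilotDataOf_of_ord` — the same for every `X` in part III's regime (`hU`, `hUS`, `hord`), via part III's own
  `exists_realising_ideles`;
* `exists_pilotData_cyclotomicField_five_realising_not_isPilotDataOf` — part IV's `ℚ(ζ₅)` datum carries realising ideles AND is the
  pilot datum of no initial Θ-datum over `ℚ(ζ₅)`.
So the census word for Y-21ℓ's realising countermodel reads «at FREE Dupuy–Hilado pilot data of the realising class
(`2l·e_v ∣ ord_v(q_v)`, `U` unramified) — a class DISJOINT from the pilot data of initial Θ-data at the `F`-level»; for those data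
(and for block C's `K`-level repair `pilotDataOfK`, p434046, where `U` ramifies) the realising window question is not addressed
by parts III/IV. Nothing here touches the kernel content of p470908 / p471645 / p472542 / p473715 (all AGREE on lane 2).
[cite: Mochizuki2012, IUTchI Def. 3.1 (c) p. 62, Ex. 3.2 (iv) p. 71] [cite: DupuyHilado2025, §3.3, §3.4]. Standard axioms.
-/

noncomputable section

open NumberField IsDedekindDomain

namespace Summit.ABC.IUTFork.Joshi.TestATS4LowerBound

open Thm311 Thm311.Real Cor312Prov Literature.IUT.LogVolume Literature.IUT.HodgeTheaters
  Literature.NumberTheory.NumberFields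

variable {F K Fbar : Type} [Field F] [NumberField F] [Field K] [NumberField K] [Algebra F K] [Field Fbar]
  [Algebra F Fbar] [Algebra K Fbar] {E : WeierstrassCurve F} [E.IsElliptic] {l : ℕ} {Pb : BadPlacePredicates K}

/-- **Realising `q`-ideles exclude initial Θ-data.** If some non-zero `q`-idele `t_q` at the pilot datum `X` over `F` realises
`P_q` in print's normalisation (`log ‖t_{q,v}‖ = −X.qPilot(v)·log N(v)/n_v`, the hypothesis `htq` of p472542), then `X` is the
pilot datum of NO initial Θ-datum `D` over `F` — contrapositive of block C's p432420
`Conditional.SideVacuity.not_realising_qIdeles_of_isPilotDataOf` ([IUTchI] Def. 3.1 (c): `l ∤ ord_v(q_v)`).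
[cite: Mochizuki2012, IUTchI Def. 3.1 (c) p. 62] [cite: DupuyHilado2025, §3.4] -/
theorem not_isPilotDataOf_of_realising_qIdeles (X : PilotData F)
    (tq : ∀ (pp : Nat.Primes) (x : (thetaIndex X).Fibre (.inr pp)), haveI : Fact (pp : ℕ).Prime := ⟨pp.2⟩; kOf X pp.1 x)
    (htq0 : ∀ pp x, tq pp x ≠ 0)
    (htq : ∀ (pp : Nat.Primes) (x : (thetaIndex X).Fibre (.inr pp)),
      haveI : Fact (pp : ℕ).Prime := ⟨pp.2⟩;
      Real.log ‖tq pp x‖ = -(X.qPilot (placeOf X pp.1 x)) * logNorm F (placeOf X pp.1 x) /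
        localDegree F (placeOf X pp.1 x))
    (D : InitialThetaData F K Fbar E l Pb) : ¬ IsPilotDataOf D X :=
  fun hX => Conditional.SideVacuity.not_realising_qIdeles_of_isPilotDataOf D X hX tq htq0 htq

/-- **Part III's realising regime excludes initial Θ-data.** At pilot data `X` over `F` whose bad places fill the fibres over `U`
(`hU`, `hUS`) with `ord_v(q_v) = 2l·e_v·m_q(p)` over `p ∈ U` (`hord`) — the regime of p472542
`statement_and_not_cor91111_of_realising` — `X` is the pilot datum of NO initial Θ-datum over `F`: part III's own
`exists_realising_ideles` supplies a realising `q`-idele, excluded by `not_isPilotDataOf_of_realising_qIdeles`.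
[cite: Mochizuki2012, IUTchI Def. 3.1 (c) p. 62] [cite: DupuyHilado2025, §3.3, §3.4] -/
theorem not_isPilotDataOf_of_ord (X : PilotData F) (U : Finset Nat.Primes)
    (hU : ∀ (pp : Nat.Primes) (x : (thetaIndex X).Fibre (.inr pp)),
      haveI : Fact (pp : ℕ).Prime := ⟨pp.2⟩; placeOf X pp.1 x ∈ X.S → pp ∈ U)
    (hUS : ∀ (pp : Nat.Primes), pp ∈ U → ∀ (x : (thetaIndex X).Fibre (.inr pp)),
      haveI : Fact (pp : ℕ).Prime := ⟨pp.2⟩; placeOf X pp.1 x ∈ X.S)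
    (mq : Nat.Primes → ℕ)
    (hord : ∀ (pp : Nat.Primes), pp ∈ U → ∀ (x : (thetaIndex X).Fibre (.inr pp)),
      haveI : Fact (pp : ℕ).Prime := ⟨pp.2⟩;
      (X.ordq (placeOf X pp.1 x) : ℝ) = 2 * X.l * ramIdx F (placeOf X pp.1 x) * mq pp)
    (D : InitialThetaData F K Fbar E l Pb) : ¬ IsPilotDataOf D X := by
  obtain ⟨tq, _t, htq0, -, -, -, -, htq⟩ := exists_realising_ideles X U hU hUS mq hord
  exact not_isPilotDataOf_of_realising_qIdeles X tq htq0 htq D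

/-- **Part IV's `ℚ(ζ₅)` datum is free, not initial.** The pilot datum over `ℚ(ζ₅)` of p473715
`exists_pilotData_cyclotomicField_five_realising_hypotheses` (`j_E := 3^{−10}`, `S := V(F)₃`, `l := 5`: `ord_v(q_v) = 10 = 2·5·1·1`)
carries non-zero `q`-ideles realising `P_q`, and is the pilot datum of NO initial Θ-datum over `ℚ(ζ₅)` (for any `K`, `F̄`, `E`,
`l`, bad-place predicates). [cite: Mochizuki2012, IUTchI Def. 3.1 (c) p. 62] [cite: DupuyHilado2025, §3.3, §3.4] -/
theorem exists_pilotData_cyclotomicField_five_realising_not_isPilotDataOf :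
    ∃ X : PilotData (CyclotomicField 5 ℚ),
      (∃ tq : ∀ (pp : Nat.Primes) (x : (thetaIndex X).Fibre (.inr pp)), haveI : Fact (pp : ℕ).Prime := ⟨pp.2⟩; kOf X pp.1 x,
        (∀ pp x, tq pp x ≠ 0) ∧
        (∀ (pp : Nat.Primes) (x : (thetaIndex X).Fibre (.inr pp)),
          haveI : Fact (pp : ℕ).Prime := ⟨pp.2⟩;
          Real.log ‖tq pp x‖ = -(X.qPilot (placeOf X pp.1 x)) * logNorm (CyclotomicField 5 ℚ) (placeOf X pp.1 x) /
            localDegree (CyclotomicField 5 ℚ) (placeOf X pp.1 x))) ∧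
      ∀ {K' Fbar' : Type} [Field K'] [NumberField K'] [Algebra (CyclotomicField 5 ℚ) K'] [Field Fbar']
        [Algebra (CyclotomicField 5 ℚ) Fbar'] [Algebra K' Fbar'] {E' : WeierstrassCurve (CyclotomicField 5 ℚ)} [E'.IsElliptic]
        {l' : ℕ} {Pb' : BadPlacePredicates K'} (D : InitialThetaData (CyclotomicField 5 ℚ) K' Fbar' E' l' Pb'),
        ¬ IsPilotDataOf D X := by
  obtain ⟨X, U, mq, _p₀, _v₀, _hv₀, _hvp₀, hU, hUS, -, -, hord, -, -, -⟩ :=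
    exists_pilotData_cyclotomicField_five_realising_hypotheses
  obtain ⟨tq, _t, htq0, -, -, -, -, htq⟩ := exists_realising_ideles X U hU hUS mq hord
  refine ⟨X, ⟨tq, htq0, htq⟩, ?_⟩
  intro K' Fbar' _ _ _ _ _ _ E' _ l' Pb' D
  exact not_isPilotDataOf_of_realising_qIdeles X tq htq0 htq D

end TestATS4LowerBound

end Summit.ABC.IUTFork.Joshi

end
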